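import Literature.Analysis.SpecialFunctions.GaussianLatticeSumBound
import Mathlib.Analysis.Calculus.SmoothSeries
import HarnessLib

/-!
# The Riemann theta function in `g` variables: convergence, (quasi-)periodicity, holomorphy

The classical Riemann theta function of a `g × g` complex matrix `Ω` with positive definite
imaginary part (a point of the Siegel upper half space `𝔥_g` when `Ω` is symmetric),
`ϑ(z, Ω) = Σ_{m ∈ ℤ^g} exp(πi ᵗm Ω m + 2πi ᵗm z)`, `z ∈ ℂ^g`
(Lange–Birkenhake, *Complex Abelian Varieties*, §3.3.2 (3.10) — the classical Riemann theta
function with characteristic `[0; 0]` — and Prop. 3.3.6; Mumford, *Tata Lectures on Theta I*,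
Ch. II §1). This file gives the definition and
the foundational facts used to build sections of line bundles on the complex tori `ℂ^g/(ℤ^g + Ωℤ^g)`
(the theta functions of Lefschetz's embedding theorem, Lange–Birkenhake Ch. 3 and Thm. 4.5.1):

* `riemannThetaTerm Ω z m = exp(πi ᵗm Ω m + 2πi ᵗm z)`, `riemannTheta Ω z = Σ' m, …`;
* `norm_riemannThetaTerm` — `|exp(πi ᵗmΩm + 2πi ᵗmz)| = exp(-π ᵗm (Im Ω) m - 2π ᵗm Im z)`;
* `norm_riemannThetaTerm_le`, `summable_norm_riemannThetaTerm` — **absolute convergence**, with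
  the Gaussian majorant `exp(g A²/(2πc)) ∏ᵢ exp(-(πc/2) mᵢ²)` on the strips `|Im zᵢ| ≤ R`, under the
  hypothesis `Im Ω ≥ c > 0` as a quadratic form (`c Σ xᵢ² ≤ ᵗx (Im Ω) x`, i.e. `Im Ω` positive
  definite; `exists_pos_mul_sum_sq_le_of_posDef` supplies `c` for a positive definite real
  matrix) — Lange–Birkenhake Prop. 3.3.6 ("the series (3.10) converges absolutely and uniformly
  on every compact set");
* `riemannTheta_add_intCast` — **periodicity** `ϑ(z + n, Ω) = ϑ(z, Ω)` for `n ∈ ℤ^g`;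
* `riemannTheta_add_mulVec` — **quasi-periodicity**
  `ϑ(z + Ωn, Ω) = exp(-πi ᵗnΩn - 2πi ᵗn z) ϑ(z, Ω)` for `n ∈ ℤ^g` and symmetric `Ω`
  (Mumford II §1; Lange–Birkenhake §3.3.2 with Lemma 3.3.5: `ϑ` is a theta function for the
  lattice `Ωℤ^g ⊕ ℤ^g`);
* `differentiable_riemannTheta` — **`ϑ(·, Ω)` is holomorphic on `ℂ^g`** (Lange–Birkenhake
  Prop. 3.3.6; termwise differentiation with the same Gaussian majorant, Mathlib's
  `hasFDerivAt_tsum_of_isPreconnected`).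

Everything is proved; the two definitions have bodies; no named fact is introduced. Not here:
`ϑ ≢ 0` (Fourier coefficients), theta functions with characteristics, the functional equation.

## References

* [LangeBirkenhake1992] H. Lange, Ch. Birkenhake, Complex Abelian Varieties, §3.3.2 (3.10),
  Lemma 3.3.5, Prop. 3.3.6 (PDF pp. 172–173 of the held copy).
* [MumfordTata1] D. Mumford, Tata Lectures on Theta I, Birkhäuser 1983 (repr. 2007), Ch. II §1.
-/

noncomputable section

open Complex Real Finset Filter Topology

namespace Literature.Analysis.SpecialFunctions

variable {g : ℕ}

/-! ### Definition -/

/-- The general term `exp(πi ᵗm Ω m + 2πi ᵗm z)` of the Riemann theta series, `m ∈ ℤ^g`.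
[cite: MumfordTata1, Ch. II §1] -/
def riemannThetaTerm (Ω : Matrix (Fin g) (Fin g) ℂ) (z : Fin g → ℂ) (m : Fin g → ℤ) : ℂ :=
  cexp (π * I * ∑ i, ∑ j, (m i : ℂ) * Ω i j * (m j : ℂ) + 2 * π * I * ∑ i, (m i : ℂ) * z i)

/-- **The Riemann theta function** `ϑ(z, Ω) = Σ_{m ∈ ℤ^g} exp(πi ᵗm Ω m + 2πi ᵗm z)` of a
`g × g` complex matrix `Ω` (with `Im Ω > 0`) and `z ∈ ℂ^g` — the classical Riemann theta function
with characteristic `[0; 0]` of Lange–Birkenhake (3.10). [cite: LangeBirkenhake1992, §3.3.2 (3.10)]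
[cite: MumfordTata1, Ch. II §1] -/
def riemannTheta (Ω : Matrix (Fin g) (Fin g) ℂ) (z : Fin g → ℂ) : ℂ :=
  ∑' m : Fin g → ℤ, riemannThetaTerm Ω z m

/-- Unfolding of `riemannTheta`. [folklore] -/
theorem riemannTheta_def (Ω : Matrix (Fin g) (Fin g) ℂ) (z : Fin g → ℂ) :
    riemannTheta Ω z = ∑' m : Fin g → ℤ, riemannThetaTerm Ω z m := rfl

/-! ### The size of the general term -/

/-- `Im(ᵗm Ω m) = ᵗm (Im Ω) m` for an integer vector `m`. [folklore] -/
theorem im_sum_sum_intCast_mul (Ω : Matrix (Fin g) (Fin g) ℂ) (m : Fin g → ℤ) :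
    (∑ i, ∑ j, (m i : ℂ) * Ω i j * (m j : ℂ)).im = ∑ i, ∑ j, (m i : ℝ) * (Ω i j).im * (m j : ℝ) := by
  rw [Complex.im_sum]
  refine sum_congr rfl fun i _ => ?_
  rw [Complex.im_sum]
  refine sum_congr rfl fun j _ => ?_
  simp [Complex.mul_im, Complex.mul_re]

/-- `Im(ᵗm z) = ᵗm Im z` for an integer vector `m`. [folklore] -/
theorem im_sum_intCast_mul (z : Fin g → ℂ) (m : Fin g → ℤ) :
    (∑ i, (m i : ℂ) * z i).im = ∑ i, (m i : ℝ) * (z i).im := by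
  rw [Complex.im_sum]
  refine sum_congr rfl fun i _ => ?_
  simp [Complex.mul_im]

/-- **`|exp(πi ᵗmΩm + 2πi ᵗm z)| = exp(-π ᵗm (Im Ω) m - 2π ᵗm Im z)`.**
[cite: LangeBirkenhake1992, §3.3.2 proof of Prop. 3.3.6] -/
theorem norm_riemannThetaTerm (Ω : Matrix (Fin g) (Fin g) ℂ) (z : Fin g → ℂ) (m : Fin g → ℤ) :
    ‖riemannThetaTerm Ω z m‖ =
      rexp (-(π * ∑ i, ∑ j, (m i : ℝ) * (Ω i j).im * (m j : ℝ)) -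
        2 * π * ∑ i, (m i : ℝ) * (z i).im) := by
  rw [riemannThetaTerm, Complex.norm_exp]
  congr 1
  have hA := im_sum_sum_intCast_mul Ω m
  have hB := im_sum_intCast_mul z m
  simp only [Complex.add_re, Complex.mul_re, Complex.mul_im, Complex.I_re, Complex.I_im,
    Complex.ofReal_re, Complex.ofReal_im, Complex.re_ofNat, Complex.im_ofNat, hA, hB]
  ring

/-- Completing the square: `-c m² + A|m| ≤ -(c/2) m² + A²/(2c)` (`c > 0`). [folklore] -/
theorem neg_mul_sq_add_mul_abs_le {c : ℝ} (hc : 0 < c) (A m : ℝ) :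
    -(c * m ^ 2) + A * |m| ≤ -(c / 2 * m ^ 2) + A ^ 2 / (2 * c) := by
  have h : 0 ≤ c / 2 * (|m| - A / c) ^ 2 := by positivity
  have h2 : c / 2 * (|m| - A / c) ^ 2 = c / 2 * m ^ 2 - A * |m| + A ^ 2 / (2 * c) := by
    field_simp
    rw [← sq_abs m]
    ring
  linarith [h, h2]

/-- **A positive definite real matrix is coercive**: `Y > 0` gives `c > 0` with
`c Σ xᵢ² ≤ ᵗx Y x` for all `x ∈ ℝ^g` (minimum of the form on the unit sphere). [folklore] -/
theorem exists_pos_mul_sum_sq_le_of_posDef {Y : Matrix (Fin g) (Fin g) ℝ} (hY : Y.PosDef) :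
    ∃ c : ℝ, 0 < c ∧ ∀ x : Fin g → ℝ, c * ∑ i, x i ^ 2 ≤ ∑ i, ∑ j, x i * Y i j * x j := by
  -- the quadratic form, its positivity, continuity and homogeneity
  set q : (Fin g → ℝ) → ℝ := fun x => ∑ i, ∑ j, x i * Y i j * x j with hq
  have hq_eq : ∀ x, q x = dotProduct x (Y.mulVec x) := fun x => by
    simp only [hq, dotProduct, Matrix.mulVec, Finset.mul_sum]
    exact Finset.sum_congr rfl fun i _ => Finset.sum_congr rfl fun j _ => by ring
  have hq_pos : ∀ x, x ≠ 0 → 0 < q x := fun x hx => by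
    rw [hq_eq]
    simpa using hY.dotProduct_mulVec_pos hx
  have hq_cont : Continuous q := by
    simp only [hq]
    fun_prop
  have hq_smul : ∀ (r : ℝ) (x : Fin g → ℝ), q (r • x) = r ^ 2 * q x := fun r x => by
    simp only [hq, Pi.smul_apply, smul_eq_mul, Finset.mul_sum]
    exact Finset.sum_congr rfl fun i _ => Finset.sum_congr rfl fun j _ => by ring
  rcases Nat.eq_zero_or_pos g with hg | hg
  · subst hg
    exact ⟨1, one_pos, fun x => by simp⟩
  -- minimum on the (compact, nonempty) unit sphere
  have hK : IsCompact (Metric.sphere (0 : Fin g → ℝ) 1) := isCompact_sphere 0 1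
  have hne : (Metric.sphere (0 : Fin g → ℝ) 1).Nonempty := by
    classical
    exact ⟨Pi.single ⟨0, hg⟩ 1, by rw [mem_sphere_zero_iff_norm, Pi.norm_single, norm_one]⟩
  obtain ⟨u, huK, hu⟩ := hK.exists_isMinOn hne hq_cont.continuousOn
  have hu0 : u ≠ 0 := by
    rintro rfl
    simp at huK
  have hgpos : (0 : ℝ) < g := by exact_mod_cast hg
  refine ⟨q u / g, div_pos (hq_pos u hu0) hgpos, fun x => ?_⟩
  change q u / g * ∑ i, x i ^ 2 ≤ q x
  by_cases hx : x = 0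
  · subst hx
    have : q 0 = 0 := by simp [hq]
    simp [this]
  have hxn : 0 < ‖x‖ := norm_pos_iff.mpr hx
  have hv : ‖x‖⁻¹ • x ∈ Metric.sphere (0 : Fin g → ℝ) 1 := by
    rw [mem_sphere_zero_iff_norm, norm_smul, norm_inv, norm_norm, inv_mul_cancel₀ hxn.ne']
  have h1 : q u ≤ q (‖x‖⁻¹ • x) := (isMinOn_iff.mp hu) _ hv
  rw [hq_smul] at h1
  have h3 : ∑ i, x i ^ 2 ≤ g * ‖x‖ ^ 2 := by
    calc ∑ i, x i ^ 2 ≤ ∑ _i : Fin g, ‖x‖ ^ 2 := Finset.sum_le_sum fun i _ => by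
            have h := norm_le_pi_norm x i
            rw [Real.norm_eq_abs] at h
            rw [← sq_abs]
            exact pow_le_pow_left₀ (abs_nonneg _) h 2
      _ = g * ‖x‖ ^ 2 := by
            rw [Finset.sum_const, Finset.card_univ, Fintype.card_fin, nsmul_eq_mul]
  have h4 : q u * ‖x‖ ^ 2 ≤ q x := by
    have h5 := mul_le_mul_of_nonneg_right h1 (sq_nonneg ‖x‖)
    calc q u * ‖x‖ ^ 2 ≤ ‖x‖⁻¹ ^ 2 * q x * ‖x‖ ^ 2 := h5
      _ = q x := by field_simp
  calc q u / g * ∑ i, x i ^ 2 ≤ q u / g * (g * ‖x‖ ^ 2) :=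
        mul_le_mul_of_nonneg_left h3 (div_pos (hq_pos u hu0) hgpos).le
    _ = q u * ‖x‖ ^ 2 := by field_simp
    _ ≤ q x := h4

/-- The hypothesis `Im Ω ≥ c > 0` of this file from positive definiteness of `Im Ω`
(`Ω` in the Siegel upper half space). [folklore] -/
theorem exists_pos_mul_sum_sq_le_of_posDef_im (Ω : Matrix (Fin g) (Fin g) ℂ)
    (hΩ : (Ω.map Complex.im).PosDef) :
    ∃ c : ℝ, 0 < c ∧ ∀ x : Fin g → ℝ, c * ∑ i, x i ^ 2 ≤ ∑ i, ∑ j, x i * (Ω i j).im * x j :=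
  exists_pos_mul_sum_sq_le_of_posDef hΩ

/-- **The Gaussian majorant of the general term on a strip.** If `Im Ω ≥ c > 0` as a quadratic
form and `|Im zᵢ| ≤ R`, then
`|exp(πi ᵗmΩm + 2πi ᵗmz)| ≤ exp(g (2πR)²/(2πc)) ∏ᵢ exp(-(πc/2) mᵢ²)`.
[cite: LangeBirkenhake1992, §3.3.2 proof of Prop. 3.3.6] -/
theorem norm_riemannThetaTerm_le (Ω : Matrix (Fin g) (Fin g) ℂ) {c : ℝ} (hc : 0 < c)
    (hY : ∀ x : Fin g → ℝ, c * ∑ i, x i ^ 2 ≤ ∑ i, ∑ j, x i * (Ω i j).im * x j)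
    {R : ℝ} (z : Fin g → ℂ) (hz : ∀ i, |(z i).im| ≤ R) (m : Fin g → ℤ) :
    ‖riemannThetaTerm Ω z m‖ ≤
      rexp (g * ((2 * π * R) ^ 2 / (2 * (π * c)))) * ∏ i, rexp (-(π * c / 2 * (m i : ℝ) ^ 2)) := by
  rw [norm_riemannThetaTerm, ← Real.exp_sum, ← Real.exp_add]
  refine Real.exp_le_exp.mpr ?_
  have hq := hY fun i => (m i : ℝ)
  have h1 : -(π * ∑ i, ∑ j, (m i : ℝ) * (Ω i j).im * (m j : ℝ)) ≤ -(π * (c * ∑ i, (m i : ℝ) ^ 2)) := by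
    have := mul_le_mul_of_nonneg_left hq pi_pos.le
    linarith
  have h2 : -(2 * π * ∑ i, (m i : ℝ) * (z i).im) ≤ 2 * π * R * ∑ i, |(m i : ℝ)| := by
    rw [Finset.mul_sum, Finset.mul_sum, ← Finset.sum_neg_distrib]
    refine Finset.sum_le_sum fun i _ => ?_
    have h3 : |(m i : ℝ) * (z i).im| ≤ |(m i : ℝ)| * R := by
      rw [abs_mul]
      exact mul_le_mul_of_nonneg_left (hz i) (abs_nonneg _)
    have h4 := neg_abs_le ((m i : ℝ) * (z i).im)
    nlinarith [pi_pos, abs_nonneg (m i : ℝ)]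
  have h5 : ∀ i, -(π * c * (m i : ℝ) ^ 2) + 2 * π * R * |(m i : ℝ)| ≤
      -(π * c / 2 * (m i : ℝ) ^ 2) + (2 * π * R) ^ 2 / (2 * (π * c)) := fun i =>
    neg_mul_sq_add_mul_abs_le (mul_pos pi_pos hc) (2 * π * R) (m i : ℝ)
  calc -(π * ∑ i, ∑ j, (m i : ℝ) * (Ω i j).im * (m j : ℝ)) - 2 * π * ∑ i, (m i : ℝ) * (z i).im
      ≤ -(π * (c * ∑ i, (m i : ℝ) ^ 2)) + 2 * π * R * ∑ i, |(m i : ℝ)| := by linarith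
    _ = ∑ i, (-(π * c * (m i : ℝ) ^ 2) + 2 * π * R * |(m i : ℝ)|) := by
        simp only [Finset.mul_sum]
        rw [← Finset.sum_neg_distrib, ← Finset.sum_add_distrib]
        exact Finset.sum_congr rfl fun i _ => by ring
    _ ≤ ∑ i, (-(π * c / 2 * (m i : ℝ) ^ 2) + (2 * π * R) ^ 2 / (2 * (π * c))) := Finset.sum_le_sum fun i _ => h5 i
    _ = g * ((2 * π * R) ^ 2 / (2 * (π * c))) + ∑ i, -(π * c / 2 * (m i : ℝ) ^ 2) := by
        rw [Finset.sum_add_distrib, Finset.sum_const, Finset.card_univ, Fintype.card_fin,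
          nsmul_eq_mul, add_comm]

/-- The Gaussian product majorant is summable over `ℤ^g`. [folklore] -/
theorem summable_prod_exp_neg_mul_sq {a : ℝ} (ha : 0 < a) :
    Summable fun m : Fin g → ℤ => ∏ i, rexp (-(a * (m i : ℝ) ^ 2)) := by
  have h := summable_tsum_pi_prod (fun (_ : Fin g) (n : ℤ) => rexp (-(a * (n : ℝ) ^ 2)))
    (fun _ _ => (Real.exp_pos _).le) (fun _ => by
      simpa using (tsum_exp_neg_mul_sq_le ha 0).1)
  exact h.1

/-- **Absolute convergence of the Riemann theta series** (`Im Ω ≥ c > 0`): for every `z` the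
series of norms `Σ_m |exp(πi ᵗmΩm + 2πi ᵗmz)|` converges (Lange–Birkenhake Prop. 3.3.6: the
series "converges absolutely and uniformly on every compact set"). [cite: LangeBirkenhake1992, §3.3.2 Prop. 3.3.6] -/
theorem summable_norm_riemannThetaTerm (Ω : Matrix (Fin g) (Fin g) ℂ) {c : ℝ} (hc : 0 < c)
    (hY : ∀ x : Fin g → ℝ, c * ∑ i, x i ^ 2 ≤ ∑ i, ∑ j, x i * (Ω i j).im * x j) (z : Fin g → ℂ) :
    Summable fun m : Fin g → ℤ => ‖riemannThetaTerm Ω z m‖ := by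
  refine Summable.of_nonneg_of_le (fun m => norm_nonneg _)
    (fun m => norm_riemannThetaTerm_le Ω hc hY (R := ‖z‖) z (fun i => ?_) m)
    ((summable_prod_exp_neg_mul_sq (by positivity)).mul_left _)
  exact (Complex.abs_im_le_norm (z i)).trans (norm_le_pi_norm z i)

/-- The Riemann theta series converges. [cite: LangeBirkenhake1992, §3.3.2 Prop. 3.3.6] -/
theorem summable_riemannThetaTerm (Ω : Matrix (Fin g) (Fin g) ℂ) {c : ℝ} (hc : 0 < c)
    (hY : ∀ x : Fin g → ℝ, c * ∑ i, x i ^ 2 ≤ ∑ i, ∑ j, x i * (Ω i j).im * x j) (z : Fin g → ℂ) :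
    Summable (riemannThetaTerm Ω z) :=
  (summable_norm_riemannThetaTerm Ω hc hY z).of_norm

/-- `ϑ(z, Ω)` is the sum of its series. [cite: LangeBirkenhake1992, §3.3.2 Prop. 3.3.6] -/
theorem hasSum_riemannTheta (Ω : Matrix (Fin g) (Fin g) ℂ) {c : ℝ} (hc : 0 < c)
    (hY : ∀ x : Fin g → ℝ, c * ∑ i, x i ^ 2 ≤ ∑ i, ∑ j, x i * (Ω i j).im * x j) (z : Fin g → ℂ) :
    HasSum (riemannThetaTerm Ω z) (riemannTheta Ω z) :=
  (summable_riemannThetaTerm Ω hc hY z).hasSum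

/-! ### Periodicity and quasi-periodicity -/

/-- `exp(πi ᵗmΩm + 2πi ᵗm (z + n)) = exp(πi ᵗmΩm + 2πi ᵗm z)` for `n ∈ ℤ^g`. [folklore] -/
theorem riemannThetaTerm_add_intCast (Ω : Matrix (Fin g) (Fin g) ℂ) (z : Fin g → ℂ)
    (n m : Fin g → ℤ) :
    riemannThetaTerm Ω (fun i => z i + n i) m = riemannThetaTerm Ω z m := by
  unfold riemannThetaTerm
  have h : ∑ i, (m i : ℂ) * (z i + n i) = ∑ i, (m i : ℂ) * z i + ((∑ i, m i * n i : ℤ) : ℂ) := by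
    push_cast
    rw [← Finset.sum_add_distrib]
    exact Finset.sum_congr rfl fun i _ => by ring
  rw [h, mul_add, ← add_assoc, Complex.exp_add]
  conv_rhs => rw [← mul_one (cexp _)]
  congr 1
  rw [show 2 * (π : ℂ) * I * ((∑ i, m i * n i : ℤ) : ℂ) = ((∑ i, m i * n i : ℤ) : ℂ) * (2 * π * I) by
    ring]
  exact Complex.exp_int_mul_two_pi_mul_I _

/-- **Periodicity**: `ϑ(z + n, Ω) = ϑ(z, Ω)` for `n ∈ ℤ^g`. [cite: MumfordTata1, Ch. II §1]
[cite: LangeBirkenhake1992, §3.3.2] -/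
theorem riemannTheta_add_intCast (Ω : Matrix (Fin g) (Fin g) ℂ) (z : Fin g → ℂ) (n : Fin g → ℤ) :
    riemannTheta Ω (fun i => z i + n i) = riemannTheta Ω z := by
  unfold riemannTheta
  exact tsum_congr fun m => riemannThetaTerm_add_intCast Ω z n m

/-- The shift identity behind quasi-periodicity (symmetric `Ω`):
`exp(πi ᵗmΩm + 2πi ᵗm(z + Ωn)) = exp(-πi ᵗnΩn - 2πi ᵗnz) · exp(πi ᵗ(m+n)Ω(m+n) + 2πi ᵗ(m+n)z)`.
[cite: MumfordTata1, Ch. II §1] -/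
theorem riemannThetaTerm_add_mulVec (Ω : Matrix (Fin g) (Fin g) ℂ) (hΩ : ∀ i j, Ω i j = Ω j i)
    (z : Fin g → ℂ) (n m : Fin g → ℤ) :
    riemannThetaTerm Ω (fun i => z i + ∑ j, Ω i j * (n j : ℂ)) m =
      cexp (-(π * I * ∑ i, ∑ j, (n i : ℂ) * Ω i j * (n j : ℂ)) - 2 * π * I * ∑ i, (n i : ℂ) * z i) *
        riemannThetaTerm Ω z (m + n) := by
  unfold riemannThetaTerm
  rw [← Complex.exp_add]
  congr 1
  simp only [Pi.add_apply, Int.cast_add]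
  -- both sides are polynomial in the entries; reduce to the symmetry of `Ω`
  have hsym : ∑ i, ∑ j, (n i : ℂ) * Ω i j * (m j : ℂ) = ∑ i, ∑ j, (m i : ℂ) * Ω i j * (n j : ℂ) := by
    rw [Finset.sum_comm]
    exact Finset.sum_congr rfl fun i _ => Finset.sum_congr rfl fun j _ => by rw [hΩ j i]; ring
  have e1 : ∑ i, (m i : ℂ) * (z i + ∑ j, Ω i j * (n j : ℂ)) =
      ∑ i, (m i : ℂ) * z i + ∑ i, ∑ j, (m i : ℂ) * Ω i j * (n j : ℂ) := by
    rw [← Finset.sum_add_distrib]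
    refine Finset.sum_congr rfl fun i _ => ?_
    rw [mul_add, Finset.mul_sum]
    exact congrArg _ (Finset.sum_congr rfl fun j _ => by ring)
  have e2 : ∑ i, ∑ j, ((m i : ℂ) + n i) * Ω i j * ((m j : ℂ) + n j) =
      ∑ i, ∑ j, (m i : ℂ) * Ω i j * (m j : ℂ) + ∑ i, ∑ j, (m i : ℂ) * Ω i j * (n j : ℂ) +
        ∑ i, ∑ j, (n i : ℂ) * Ω i j * (m j : ℂ) + ∑ i, ∑ j, (n i : ℂ) * Ω i j * (n j : ℂ) := by
    simp only [← Finset.sum_add_distrib]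
    exact Finset.sum_congr rfl fun i _ => Finset.sum_congr rfl fun j _ => by ring
  have e3 : ∑ i, ((m i : ℂ) + n i) * z i = ∑ i, (m i : ℂ) * z i + ∑ i, (n i : ℂ) * z i := by
    rw [← Finset.sum_add_distrib]
    exact Finset.sum_congr rfl fun i _ => by ring
  rw [e1, e2, e3, hsym]
  ring

/-- **Quasi-periodicity**: for symmetric `Ω` and `n ∈ ℤ^g`,
`ϑ(z + Ωn, Ω) = exp(-πi ᵗnΩn - 2πi ᵗn z) ϑ(z, Ω)` (Mumford, Tata I, Ch. II §1; Lange–Birkenhake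
§3.3.2 with Lemma 3.3.5: `ϑ` is a theta function for the lattice `Ωℤ^g ⊕ ℤ^g`). [cite: MumfordTata1, Ch. II §1]
[cite: LangeBirkenhake1992, §3.3.2] -/
theorem riemannTheta_add_mulVec (Ω : Matrix (Fin g) (Fin g) ℂ) (hΩ : ∀ i j, Ω i j = Ω j i)
    (z : Fin g → ℂ) (n : Fin g → ℤ) :
    riemannTheta Ω (fun i => z i + ∑ j, Ω i j * (n j : ℂ)) =
      cexp (-(π * I * ∑ i, ∑ j, (n i : ℂ) * Ω i j * (n j : ℂ)) - 2 * π * I * ∑ i, (n i : ℂ) * z i) *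
        riemannTheta Ω z := by
  unfold riemannTheta
  rw [← tsum_mul_left]
  rw [show (∑' m : Fin g → ℤ, cexp (-(π * I * ∑ i, ∑ j, (n i : ℂ) * Ω i j * (n j : ℂ)) -
      2 * π * I * ∑ i, (n i : ℂ) * z i) * riemannThetaTerm Ω z m) =
      ∑' m : Fin g → ℤ, cexp (-(π * I * ∑ i, ∑ j, (n i : ℂ) * Ω i j * (n j : ℂ)) -
        2 * π * I * ∑ i, (n i : ℂ) * z i) * riemannThetaTerm Ω z (m + n) from
    ((Equiv.addRight n).tsum_eq fun m => cexp (-(π * I * ∑ i, ∑ j, (n i : ℂ) * Ω i j * (n j : ℂ)) -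
      2 * π * I * ∑ i, (n i : ℂ) * z i) * riemannThetaTerm Ω z m).symm]
  exact tsum_congr fun m => riemannThetaTerm_add_mulVec Ω hΩ z n m

/-! ### Holomorphy -/

/-- The derivative of the general term in `z`: `exp(…) · 2πi ᵗm dz`. [folklore] -/
theorem hasFDerivAt_riemannThetaTerm (Ω : Matrix (Fin g) (Fin g) ℂ) (m : Fin g → ℤ)
    (z : Fin g → ℂ) :
    HasFDerivAt (fun w => riemannThetaTerm Ω w m)
      (riemannThetaTerm Ω z m •
        ((2 * π * I) • ∑ i, (m i : ℂ) • ContinuousLinearMap.proj (R := ℂ) (φ := fun _ : Fin g => ℂ) i))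
      z := by
  have hL : HasFDerivAt (fun w : Fin g → ℂ => π * I * ∑ i, ∑ j, (m i : ℂ) * Ω i j * (m j : ℂ) +
      2 * π * I * ∑ i, (m i : ℂ) * w i)
      ((2 * π * I) • ∑ i, (m i : ℂ) • ContinuousLinearMap.proj (R := ℂ) (φ := fun _ : Fin g => ℂ) i)
      z := by
    have h1 : HasFDerivAt (fun w : Fin g → ℂ => ∑ i, (m i : ℂ) * w i)
        (∑ i, (m i : ℂ) • ContinuousLinearMap.proj (R := ℂ) (φ := fun _ : Fin g => ℂ) i) z := by
      have := HasFDerivAt.fun_sum (u := Finset.univ)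
        (A := fun i (w : Fin g → ℂ) => (m i : ℂ) * w i)
        (A' := fun i => (m i : ℂ) • ContinuousLinearMap.proj (R := ℂ) (φ := fun _ : Fin g => ℂ) i)
        (x := z) fun i _ => ((ContinuousLinearMap.proj (R := ℂ) (φ := fun _ : Fin g => ℂ) i
          ).hasFDerivAt.const_mul (m i : ℂ))
      convert this using 1
    exact ((h1.const_mul (2 * π * I)).const_add _)
  exact hL.cexp

/-- Norm of the derivative of the general term: at most `2π Σ|mᵢ|` times the norm of the term.
[folklore] -/
theorem norm_fderiv_riemannThetaTerm_le (Ω : Matrix (Fin g) (Fin g) ℂ) (m : Fin g → ℤ)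
    (z : Fin g → ℂ) :
    ‖riemannThetaTerm Ω z m •
        ((2 * π * I) • ∑ i, (m i : ℂ) • ContinuousLinearMap.proj (R := ℂ) (φ := fun _ : Fin g => ℂ) i)‖ ≤
      ‖riemannThetaTerm Ω z m‖ * (2 * π * ∑ i, |(m i : ℝ)|) := by
  rw [norm_smul]
  refine mul_le_mul_of_nonneg_left ?_ (norm_nonneg _)
  rw [norm_smul, Finset.mul_sum]
  have h2 : ‖(2 * π * I : ℂ)‖ = 2 * π := by
    rw [norm_mul, norm_mul, Complex.norm_I, mul_one, Complex.norm_ofNat, Complex.norm_real,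
      Real.norm_of_nonneg pi_pos.le]
  rw [h2]
  refine (mul_le_mul_of_nonneg_left (norm_sum_le _ _) (by positivity)).trans ?_
  rw [Finset.mul_sum]
  refine Finset.sum_le_sum fun i _ => ?_
  refine mul_le_mul_of_nonneg_left ?_ (by positivity)
  rw [norm_smul]
  calc ‖(m i : ℂ)‖ * ‖ContinuousLinearMap.proj (R := ℂ) (φ := fun _ : Fin g => ℂ) i‖
      ≤ ‖(m i : ℂ)‖ * 1 :=
        mul_le_mul_of_nonneg_left (ContinuousLinearMap.opNorm_le_bound _ zero_le_one fun x => by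
          rw [one_mul]; exact norm_le_pi_norm x i) (norm_nonneg _)
    _ = |(m i : ℝ)| := by rw [mul_one, ← Complex.ofReal_intCast, Complex.norm_real, Real.norm_eq_abs]

/-- `Σᵢ |mᵢ| ≤ exp(Σᵢ |mᵢ|)`, to absorb the polynomial factor of the derivative. [folklore] -/
theorem sum_abs_le_exp (m : Fin g → ℤ) : ∑ i, |(m i : ℝ)| ≤ rexp (∑ i, |(m i : ℝ)|) :=
  (Real.add_one_le_exp _).trans' (by linarith)

/-- **The Riemann theta function is holomorphic in `z`** (on all of `ℂ^g`; termwise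
differentiation, the series of derivatives being dominated on every ball by a Gaussian majorant).
[cite: LangeBirkenhake1992, §3.3.2 Prop. 3.3.6] [cite: LangeBirkenhake1992, §3.3.2] -/
theorem differentiable_riemannTheta (Ω : Matrix (Fin g) (Fin g) ℂ) {c : ℝ} (hc : 0 < c)
    (hY : ∀ x : Fin g → ℝ, c * ∑ i, x i ^ 2 ≤ ∑ i, ∑ j, x i * (Ω i j).im * x j) :
    Differentiable ℂ (riemannTheta Ω) := by
  intro z₀
  -- work on the ball of radius `1` about `z₀`, where `|Im zᵢ| ≤ ‖z₀‖ + 1 =: R`; `A = 2πR + 1`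
  set R : ℝ := ‖z₀‖ + 1 with hR
  set A : ℝ := 2 * π * R + 1 with hA
  have hball : ∀ z ∈ Metric.ball z₀ 1, ∀ i, |(z i).im| ≤ R := by
    intro z hz i
    have h1 : ‖z‖ ≤ ‖z₀‖ + 1 := by
      have := norm_le_norm_add_norm_sub' z z₀
      have h2 : ‖z - z₀‖ < 1 := by rwa [← dist_eq_norm]
      linarith
    exact ((Complex.abs_im_le_norm (z i)).trans (norm_le_pi_norm z i)).trans h1
  -- the majorant of the derivatives
  set u : (Fin g → ℤ) → ℝ := fun m =>
    2 * π * (rexp (g * (A ^ 2 / (2 * (π * c)))) *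
      ∏ i, rexp (-(π * c / 2 * (m i : ℝ) ^ 2))) with hu
  have hu_sum : Summable u := ((summable_prod_exp_neg_mul_sq (by positivity)).mul_left _).mul_left _
  have hderiv_le : ∀ (m : Fin g → ℤ) (z : Fin g → ℂ), z ∈ Metric.ball z₀ 1 →
      ‖riemannThetaTerm Ω z m • ((2 * π * I) •
        ∑ i, (m i : ℂ) • ContinuousLinearMap.proj (R := ℂ) (φ := fun _ : Fin g => ℂ) i)‖ ≤ u m := by
    intro m z hz
    refine (norm_fderiv_riemannThetaTerm_le Ω m z).trans ?_
    -- `‖term‖ · 2π Σ|mᵢ| ≤ 2π ‖term at the shifted strip‖`-type bound via `Σ|mᵢ| ≤ exp Σ|mᵢ|`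
    have hn := norm_riemannThetaTerm Ω z m
    have key : ‖riemannThetaTerm Ω z m‖ * ∑ i, |(m i : ℝ)| ≤
        rexp (g * (A ^ 2 / (2 * (π * c)))) * ∏ i, rexp (-(π * c / 2 * (m i : ℝ) ^ 2)) := by
      refine (mul_le_mul_of_nonneg_left (sum_abs_le_exp m) (norm_nonneg _)).trans ?_
      rw [hn, ← Real.exp_add, ← Real.exp_sum, ← Real.exp_add]
      refine Real.exp_le_exp.mpr ?_
      have hq := hY fun i => (m i : ℝ)
      have h1 : -(π * ∑ i, ∑ j, (m i : ℝ) * (Ω i j).im * (m j : ℝ)) ≤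
          -(π * (c * ∑ i, (m i : ℝ) ^ 2)) := by
        have := mul_le_mul_of_nonneg_left hq pi_pos.le
        linarith
      have h2 : -(2 * π * ∑ i, (m i : ℝ) * (z i).im) ≤ 2 * π * R * ∑ i, |(m i : ℝ)| := by
        rw [Finset.mul_sum, Finset.mul_sum, ← Finset.sum_neg_distrib]
        refine Finset.sum_le_sum fun i _ => ?_
        have h3 : |(m i : ℝ) * (z i).im| ≤ |(m i : ℝ)| * R := by
          rw [abs_mul]
          exact mul_le_mul_of_nonneg_left (hball z hz i) (abs_nonneg _)
        have h4 := neg_abs_le ((m i : ℝ) * (z i).im)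
        nlinarith [pi_pos, abs_nonneg (m i : ℝ)]
      have h5 : ∀ i, -(π * c * (m i : ℝ) ^ 2) + A * |(m i : ℝ)| ≤
          -(π * c / 2 * (m i : ℝ) ^ 2) + A ^ 2 / (2 * (π * c)) := fun i =>
        neg_mul_sq_add_mul_abs_le (mul_pos pi_pos hc) A (m i : ℝ)
      have hRA : 2 * π * R * ∑ i, |(m i : ℝ)| + ∑ i, |(m i : ℝ)| = A * ∑ i, |(m i : ℝ)| := by
        rw [hA]
        ring
      calc -(π * ∑ i, ∑ j, (m i : ℝ) * (Ω i j).im * (m j : ℝ)) - 2 * π * ∑ i, (m i : ℝ) * (z i).im +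
            ∑ i, |(m i : ℝ)|
          ≤ -(π * (c * ∑ i, (m i : ℝ) ^ 2)) + A * ∑ i, |(m i : ℝ)| := by linarith
        _ = ∑ i, (-(π * c * (m i : ℝ) ^ 2) + A * |(m i : ℝ)|) := by
            simp only [Finset.mul_sum]
            rw [← Finset.sum_neg_distrib, ← Finset.sum_add_distrib]
            exact Finset.sum_congr rfl fun i _ => by ring
        _ ≤ ∑ i, (-(π * c / 2 * (m i : ℝ) ^ 2) + A ^ 2 / (2 * (π * c))) :=
            Finset.sum_le_sum fun i _ => h5 i
        _ = g * (A ^ 2 / (2 * (π * c))) + ∑ i, -(π * c / 2 * (m i : ℝ) ^ 2) := by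
            rw [Finset.sum_add_distrib, Finset.sum_const, Finset.card_univ, Fintype.card_fin,
              nsmul_eq_mul, add_comm]
    rw [hu]
    calc ‖riemannThetaTerm Ω z m‖ * (2 * π * ∑ i, |(m i : ℝ)|)
        = 2 * π * (‖riemannThetaTerm Ω z m‖ * ∑ i, |(m i : ℝ)|) := by ring
      _ ≤ 2 * π * (rexp (g * (A ^ 2 / (2 * (π * c)))) *
            ∏ i, rexp (-(π * c / 2 * (m i : ℝ) ^ 2))) :=
          mul_le_mul_of_nonneg_left key (by positivity)
  have hz₀ : z₀ ∈ Metric.ball z₀ 1 := Metric.mem_ball_self one_pos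
  have h := hasFDerivAt_tsum_of_isPreconnected hu_sum Metric.isOpen_ball
    (convex_ball z₀ 1).isPreconnected (fun m z _ => hasFDerivAt_riemannThetaTerm Ω m z)
    hderiv_le hz₀ (summable_riemannThetaTerm Ω hc hY z₀) hz₀
  exact h.differentiableAt

end Literature.Analysis.SpecialFunctions

end
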